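import Mathlib
import Summits.KontsevichZagierPeriods.KontsevichZagierPeriods.Theorems.SoloInformedLocusBand
import Summits.KontsevichZagierPeriods.KontsevichZagierPeriods.Theorems.SoloInformedLogRoom
import HarnessLib

/-!
# Solo-informed (A390-ii): KERNEL LEMMA I — integrability loci are `ℚ`-semialgebraic

File F5d, the induction.  **LEMMA I** (`soloInformed_finLocus`, conditional on the Lion–Rolin
preparation fact `semialgebraicPreparation`): for a `ℚ`-semialgebraic `S ⊆ ℝ^{k+m}` and a
`ℚ`-semialgebraic `G : S → ℝ`, the set of parameters `t ∈ ℝᵏ` for which `x ↦ 1_S G (t, x)` is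
integrable over `ℝᵐ` is `ℚ`-semialgebraic.

Induction on `m`; the step `m → m + 1` prepares `G` with respect to the last variable
(`soloInformed_preparedCover`), passes to the pieces of the cover (`soloInformed_locus_of_cover`;
graphs carry no mass) and treats each band by `soloInformed_band_locus`, which consumes LEMMA I and
the log-room theorem `soloInformed_logRoom` in dimension `m`.  The `Integrable` form is
`soloInformed_integrableLocus`.
-/

open MeasureTheory Set Real
open scoped ENNReal
open Literature.ModelTheory.ExponentialFields Literature.NumberTheory.Transcendental
  Literature.NumberTheory.Sieve

namespace Summit.KontsevichZagierPeriods.KontsevichZagierPeriods.Theorems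

/-- The extension by zero of `|G|` is the absolute value of the extension by zero of `G`. -/
theorem soloInformed_indicator_abs_eq {α : Type*} (S : Set α) (G : α → ℝ) :
    (S.indicator fun w => |G w|) = fun z => |S.indicator G z| := by
  funext z
  by_cases hz : z ∈ S
  · rw [indicator_of_mem hz, indicator_of_mem hz]
  · rw [indicator_of_notMem hz, indicator_of_notMem hz, abs_zero]

/-- **Inductive step** of LEMMA I:
`SoloInformedFinLocusAt k m → SoloInformedLogRoomAt k m → SoloInformedFinLocusAt k (m + 1)`,
granted the preparation fact. -/
theorem soloInformed_finLocus_succ (hprep : semialgebraicPreparation) {k m : ℕ}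
    (ihI : SoloInformedFinLocusAt k m) (ihT : SoloInformedLogRoomAt k m) :
    SoloInformedFinLocusAt k (m + 1) := by
  intro S G hS hG
  classical
  have hGm : Measurable (S.indicator G) := soloInformed_measurable_indicator_sa hS hG
  have hSm : MeasurableSet S := hS.measurableSet_holds
  have hΦm : Measurable fun z => ENNReal.ofReal (S.indicator (fun w => |G w|) z) := by
    rw [soloInformed_indicator_abs_eq S G]
    exact ENNReal.measurable_ofReal.comp (continuous_abs.measurable.comp hGm)
  -- prepare `G` with respect to the last variable
  obtain ⟨κT, _, B, l, ξ, j, κ'T, _, B', η, hB, hξ, hsub, hB', hη, hcov, hprepd⟩ :=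
    soloInformed_preparedCover hprep (n := k + m) 0 hS (fun _ => G) (fun _ => hG)
  -- rewrite the locus with the integrand extended by zero
  suffices key : IsSemialgebraic ℚ {t : Fin k → ℝ | ∫⁻ x : Fin (m + 1) → ℝ,
      S.indicator (fun z => ENNReal.ofReal (S.indicator (fun w => |G w|) z))
        (Fin.append t x : Fin (k + (m + 1)) → ℝ) < ∞} by
    rw [soloInformed_indicator_ofReal_indicator S] at key
    exact key
  refine soloInformed_locus_of_cover (ι := κT ⊕ κ'T) (B := S)
    (Sum.elim (fun κ => bandOver (B κ) (ξ κ) (j κ)) (fun κ' => graphOver (B' κ') (η κ') ∩ S))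
    ?_ ?_ hΦm (fun z hz => Or.inr ?_) ?_
  · -- the pieces lie in `S`
    rintro (κ | κ')
    · exact hsub κ
    · exact inter_subset_right
  · -- measurability of the pieces
    rintro (κ | κ')
    · exact (soloInformed_isSemialgebraic_bandOver (hB κ) (hξ κ) (j κ)).measurableSet_holds
    · exact ((isSemialgebraicFunOn_iff_isSemialgebraic_graphOver).mp
        (hη κ')).measurableSet_holds.inter hSm
  · -- cover
    rcases hcov hz with h | h
    · obtain ⟨κ, hκ⟩ := mem_iUnion.mp h
      exact ⟨Sum.inl κ, hκ⟩
    · obtain ⟨κ', hκ'⟩ := mem_iUnion.mp h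
      exact ⟨Sum.inr κ', hκ', hz⟩
  · -- loci piece by piece
    rintro (κ | κ')
    · -- a prepared band
      have d₀ : SoloInformedLRData (B κ) (bandOver (B κ) (ξ κ) (j κ)) G :=
        Classical.choice (soloInformed_lrData_nonempty (hprepd κ 0))
      exact soloInformed_band_locus ihI ihT (hB κ) (hξ κ) (j κ) d₀ hΦm
        (fun z hz => by rw [indicator_of_mem (hsub κ hz)])
    · -- a graph carries no mass: the locus is everything
      have h0 : ∀ t : Fin k → ℝ, ∫⁻ x : Fin (m + 1) → ℝ, (graphOver (B' κ') (η κ') ∩ S).indicator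
          (fun z => ENNReal.ofReal (S.indicator (fun w => |G w|) z))
          (Fin.append t x : Fin (k + (m + 1)) → ℝ) < ∞ := fun t => by
        refine lt_of_le_of_lt (lintegral_mono fun x =>
          indicator_le_indicator_of_subset inter_subset_left (fun _ => zero_le) _) ?_
        rw [soloInformed_lintegral_graphOver_append
          (soloInformed_measurable_indicator_sa (hB' κ') (hη κ')) _ t]
        exact ENNReal.zero_lt_top
      have hu : {t : Fin k → ℝ | ∫⁻ x : Fin (m + 1) → ℝ, (graphOver (B' κ') (η κ') ∩ S).indicator
          (fun z => ENNReal.ofReal (S.indicator (fun w => |G w|) z))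
          (Fin.append t x : Fin (k + (m + 1)) → ℝ) < ∞} = univ :=
        eq_univ_of_forall h0
      show IsSemialgebraic ℚ {t : Fin k → ℝ | ∫⁻ x : Fin (m + 1) → ℝ,
        (graphOver (B' κ') (η κ') ∩ S).indicator
          (fun z => ENNReal.ofReal (S.indicator (fun w => |G w|) z))
          (Fin.append t x : Fin (k + (m + 1)) → ℝ) < ∞}
      rw [hu]
      exact isSemialgebraic_univ

/-- **KERNEL LEMMA I** (conditional on the Lion–Rolin preparation fact): integrability loci of
`ℚ`-semialgebraic families are `ℚ`-semialgebraic, in every fibre dimension `m` and for every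
parameter block of length `k`. -/
theorem soloInformed_finLocus (hprep : semialgebraicPreparation) (k : ℕ) :
    ∀ m, SoloInformedFinLocusAt k m
  | 0 => soloInformed_finLocus_zero k
  | m + 1 => soloInformed_finLocus_succ hprep (soloInformed_finLocus hprep k m)
      (soloInformed_logRoom hprep k m)

/-- **KERNEL LEMMA I, `Integrable` form.**  For a `ℚ`-semialgebraic `S ⊆ ℝ^{k+m}` and a
`ℚ`-semialgebraic `G` on `S`, the set of parameters `t ∈ ℝᵏ` at which `x ↦ 1_S G (t, x)` is
integrable over `ℝᵐ` is `ℚ`-semialgebraic. -/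
theorem soloInformed_integrableLocus (hprep : semialgebraicPreparation) {k m : ℕ}
    {S : Set (Fin (k + m) → ℝ)} {G : (Fin (k + m) → ℝ) → ℝ} (hS : IsSemialgebraic ℚ S)
    (hG : IsSemialgebraicFunOn ℚ S G) :
    IsSemialgebraic ℚ {t : Fin k → ℝ |
      Integrable (fun x : Fin m → ℝ => S.indicator G (Fin.append t x))} := by
  have hGm : Measurable (S.indicator G) := soloInformed_measurable_indicator_sa hS hG
  have hset : {t : Fin k → ℝ | Integrable (fun x : Fin m → ℝ => S.indicator G (Fin.append t x))} =
      {t : Fin k → ℝ |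
        ∫⁻ x, ENNReal.ofReal (S.indicator (fun w => |G w|) (Fin.append t x)) < ∞} := by
    ext t
    have hmeas : AEStronglyMeasurable (fun x : Fin m → ℝ => S.indicator G (Fin.append t x))
        volume :=
      (hGm.comp (FordMaynard.measurable_append_right t)).aestronglyMeasurable
    rw [mem_setOf_eq, mem_setOf_eq, Integrable, and_iff_right hmeas, hasFiniteIntegral_iff_norm]
    simp only [Real.norm_eq_abs, soloInformed_indicator_abs_eq]
  rw [hset]
  exact soloInformed_finLocus hprep k m S G hS hG

end Summit.KontsevichZagierPeriods.KontsevichZagierPeriods.Theorems
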